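import Literature.NumberTheory.EllipticCurves.Castella2018.AnticyclotomicSelmerDual
import Summits.BirchSwinnertonDyer.Rank1Residual.X2.NonPrimitiveLambdaShift
import HarnessLib

/-!
# The `λ`-shift of Castella's anticyclotomic Selmer dual `X_ac^Σ(E[p^∞])` along `Σ₁ ⊆ Σ₂`:
# `λ(X^{Σ₂}) = λ(X^{Σ₁}) + corank_{ℤ_p}(Sel_𝔭^{Σ₂}/Sel_𝔭^{Σ₁})` from `μ(X^{Σ₂}) = 0`

Cell `bsd-eis` (home `run/shared/lean/pub/bsd-eis/`), seat `bsd-eis-k5-c2` g11, crux 2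
`GoodLatticeBDPValue` (stmt-BirchSwinnertonDyer-19032), line `halves`, OPTION (B0) of planner RULING
L94 ADDENDUM (6): the kernel part of the primitive/imprimitive step "A9" (Keller–Yin arXiv:2402.12781v2
Thm. 1.5.1 ⇐ Thm. 1.4.1; Castella–Grossi–Lee–Skinner 2022 Thm. 1.5.1 ⇐ Thm. 1.4.x: "`λ(𝔛_f^S) =
λ(𝔛_f) + Σ_{w∈S} λ(𝒫_w(f))`"), for the CURVE's module in the tree's currency
`Castella2018.AcSelmer.XAc W p κ 𝔭 S γ = Hom(Sel_𝔭^Σ(K_∞, E[p^∞]), ℚ/ℤ)` (the object of the typed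
[ALG] statement `KellerYin2024.thm151_algmain_goodLattice_OPEN`).

HONEST FRAMING: tool theorems only (no definition, no named fact, no `sorry`); nothing here is
specific to Eisenstein primes; BSD is proved for no curve; no label or count moves.

## What

For a number field `K`, an elliptic curve `W/K`, a prime `p`, a `ℤ_p`-extension `κ` with a
topological generator `γ`, a place `𝔭` and sets of places `S₁ ⊆ S₂`, write
`Sel^{Sᵢ} = AcSelmer.selmerAc W p κ 𝔭 Sᵢ` (Castella 2018 Def. 2.2, `Σ`-imprimitive: no condition at
`Sᵢ`) and `X^{Sᵢ} = AcSelmer.XAc W p κ 𝔭 Sᵢ γ` (its Pontryagin dual with the CONSTRUCTED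
`Λ = ℤ_p⟦T⟧`-structure, `T = γ − 1`).

* §1 `smulFun_comp_inclusion`: the canonical `Λ`-action is natural along `Sel^{S₁} ↪ Sel^{S₂}`.
* §2 `exists_restrict`: the restriction of characters `r : X^{S₂} → X^{S₁}` is `Λ`-LINEAR and ONTO
  (`ℚ/ℤ` injective), with kernel the characters vanishing on `Sel^{S₁}`;
  `nonempty_ker_addEquiv_characterModule`: `ker r ≃ Hom(Sel^{S₂}/Sel^{S₁}, ℚ/ℤ)`.
* §3 **`lambdaInvariant_eq_add_zpCorank_of_muInvariant_eq_zero`**: if `X^{S₂}` is finitely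
  generated and `Λ`-torsion with `μ(X^{S₂}) = 0`, then `X^{S₁}` is finitely generated and torsion
  with `μ(X^{S₁}) = 0`, the `p`-torsion of `Sel^{S₂}/Sel^{S₁}` is finite, and
  **`λ(X^{S₂}) = λ(X^{S₁}) + corank_{ℤ_p}(Sel^{S₂}/Sel^{S₁})`**. The `μ = 0` hypothesis on the
  IMPRIMITIVE dual (which KY Thm. 1.4.1 supplies) replaces the local finiteness input of the b2b
  cell's `X2.NonPrimitiveLambdaShift.lambdaInvariant_eq_add_zpCorank_quotient` (stated for the
  Greenberg–Vatsal constructor `datumSelmerInfty`, not for Castella's `selmerAc`): `μ(ker r) ≤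
  μ(X^{S₂}) = 0`, so `ker r ≅ Hom(Sel^{S₂}/Sel^{S₁}, ℚ/ℤ)` is finitely generated over `ℤ_p` and
  `corank_{ℤ_p}(Sel^{S₂}/Sel^{S₁}) = λ(ker r)` (`X2.NonPrimitiveSelmerCorank`), while `λ` is additive
  along `r` (`X2.DualRestrictionInvariants`). What is NOT here: the VALUE `Σ_{w∈S} λ(𝒫_w(f))` of
  that corank (Pollack–Weston 2011 Prop. A.2 surjectivity + the local Euler-factor lemma) — a
  published input, typed separately.

References: Greenberg–Vatsal 2000 §2 Cor. (2.3) and p. 21 ("`corank_𝒪` of a `Λ`-cotorsion group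
being the `λ`-invariant of its dual"); CGLS 2022 proof of Thm. 1.5.1; KY 2024 proof of Thm. 1.5.1
(TeX L1358–1360); Castella 2018 Def. 2.2.
-/

set_option linter.dupNamespace false
set_option autoImplicit false

noncomputable section

open scoped Classical AddSubgroup

open NumberField IsDedekindDomain Field
open Summit.BirchSwinnertonDyer.Rank1Residual
open Literature.NumberTheory.EllipticCurves Literature.NumberTheory.EllipticCurves.GreenbergSelmer
  Literature.NumberTheory.EllipticCurves.IwasawaDual
  Literature.NumberTheory.EllipticCurves.Castella2018 Literature.NumberTheory.EllipticCurves.Castella2018.AcSelmer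
  Literature.NumberTheory.GaloisRepresentations

universe u

namespace Summit.BirchSwinnertonDyer.BirchSwinnertonDyer.Theorems.XAcImprimitiveLambdaShift

variable {K : Type u} [Field K] [NumberField K] (W : WeierstrassCurve K) (p : ℕ) [Fact p.Prime]
  (κ : ZpExtension K p) (𝔭 : HeightOneSpectrum (𝓞 K)) {S₁ S₂ : Set (HeightOneSpectrum (𝓞 K))}

/-! ## §1. Naturality of the canonical `Λ`-action along `Sel^{S₁} ↪ Sel^{S₂}` -/

/-- `Sel_𝔭^{S₁} ≤ Sel_𝔭^{S₂}` for `S₁ ⊆ S₂` (dropping local conditions enlarges the group).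
[cite: Castella2018, Def. 2.2 (arXiv:1704.06608 p. 5)] -/
theorem selmerAc_mono (h12 : S₁ ⊆ S₂) : selmerAc W p κ 𝔭 S₁ ≤ selmerAc W p κ 𝔭 S₂ :=
  selmerOver_mono h12

/-- The inclusion `Sel^{S₁} ↪ Sel^{S₂}` intertwines `conj_γ` (both are `conjH1 γ` on classes).
[cite: Castella2018, §2.1–2.2 (arXiv:1704.06608 p. 5)] -/
theorem inclusion_conjSelmerAc (h12 : S₁ ⊆ S₂) (γ : absoluteGaloisGroup K) (s : selmerAc W p κ 𝔭 S₁) :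
    AddSubgroup.inclusion (selmerAc_mono W p κ 𝔭 h12) (conjSelmerAc W p κ 𝔭 S₁ γ s) =
      conjSelmerAc W p κ 𝔭 S₂ γ (AddSubgroup.inclusion (selmerAc_mono W p κ 𝔭 h12) s) :=
  Subtype.ext (by
    rw [AddSubgroup.coe_inclusion, coe_conjSelmerAc_apply, coe_conjSelmerAc_apply,
      AddSubgroup.coe_inclusion])

/-- The inclusion intertwines the powers of `ψ = conj_γ − 1`. [folklore] -/
theorem inclusion_conj_sub_one_pow_apply (h12 : S₁ ⊆ S₂) (γ : absoluteGaloisGroup K) (i : ℕ)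
    (s : selmerAc W p κ 𝔭 S₁) :
    AddSubgroup.inclusion (selmerAc_mono W p κ 𝔭 h12) (((conjSelmerAc W p κ 𝔭 S₁ γ - 1) ^ i) s) =
      ((conjSelmerAc W p κ 𝔭 S₂ γ - 1) ^ i) (AddSubgroup.inclusion (selmerAc_mono W p κ 𝔭 h12) s) := by
  induction i generalizing s with
  | zero => rw [pow_zero, pow_zero, AddMonoid.End.one_apply, AddMonoid.End.one_apply]
  | succ i ih =>
    rw [pow_succ, pow_succ, AddMonoid.End.coe_mul, AddMonoid.End.coe_mul, Function.comp_apply,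
      Function.comp_apply, ih, IwasawaDual.End_sub_apply, IwasawaDual.End_sub_apply,
      AddMonoid.End.one_apply, AddMonoid.End.one_apply, map_sub, inclusion_conjSelmerAc W p κ 𝔭 h12]

/-- **Naturality of the canonical `Λ`-action along `Sel^{S₁} ↪ Sel^{S₂}`**: restricting a character
of `Sel^{S₂}` to `Sel^{S₁}` commutes with `f ⋆ ·` (`γ` a topological generator; the action is the
finite sum `IwasawaDual.evalT`, termwise compatible with the inclusion). [cite: GreenbergLNM1716, §1 (after Conj. 1.3)] -/
theorem smulFun_comp_inclusion (h12 : S₁ ⊆ S₂) {γ : absoluteGaloisGroup K} (hγ : κ.IsTopGenerator γ)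
    (f : IwasawaAlgebra p) (x : selmerAc W p κ 𝔭 S₂ →+ AddCircle (1 : ℚ)) :
    ((isLocNil_conjSelmerAc_sub_one W p κ 𝔭 S₂ hγ).smulFun f x).comp
        (AddSubgroup.inclusion (selmerAc_mono W p κ 𝔭 h12)) =
      (isLocNil_conjSelmerAc_sub_one W p κ 𝔭 S₁ hγ).smulFun f
        (x.comp (AddSubgroup.inclusion (selmerAc_mono W p κ 𝔭 h12))) := by
  set h₂ := isLocNil_conjSelmerAc_sub_one W p κ 𝔭 S₂ hγ
  set h₁ := isLocNil_conjSelmerAc_sub_one W p κ 𝔭 S₁ hγ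
  set ι := AddSubgroup.inclusion (selmerAc_mono W p κ 𝔭 h12) with hι
  ext s
  obtain ⟨N, hN⟩ := h₁.nil s
  obtain ⟨k, hk⟩ := h₁.torsion s
  have hN₂ : ((conjSelmerAc W p κ 𝔭 S₂ γ - 1) ^ N) (ι s) = 0 := by
    rw [hι, ← inclusion_conj_sub_one_pow_apply W p κ 𝔭 h12 γ N s, hN, map_zero]
  have hk₂ : p ^ k • ι s = 0 := by rw [← map_nsmul, hk, map_zero]
  rw [AddMonoidHom.comp_apply, h₂.smulFun_apply f x hN₂ hk₂, h₁.smulFun_apply f _ hN hk,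
    IwasawaDual.evalT_def, IwasawaDual.evalT_def]
  refine Finset.sum_congr rfl fun i _ ↦ ?_
  rw [AddMonoidHom.comp_apply, hι, inclusion_conj_sub_one_pow_apply W p κ 𝔭 h12 γ i s]

/-! ## §2. The restriction `r : X^{S₂} ↠ X^{S₁}`: `Λ`-linear, onto, kernel `≅ Hom(Sel^{S₂}/Sel^{S₁}, ℚ/ℤ)` -/

variable (γ : absoluteGaloisGroup K) [hγ : Fact (κ.IsTopGenerator γ)]

/-- **The restriction of characters `X^{S₂} → X^{S₁}` is a `Λ`-LINEAR SURJECTION** whose kernel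
consists of the characters vanishing on `Sel^{S₁}` (linearity: both `Λ`-structures are the
canonical `IsLocNil.module`, natural along the inclusion by `smulFun_comp_inclusion`; onto:
characters of a subgroup extend, `ℚ/ℤ` being injective — `CharacterModule.dual_surjective_of_injective`).
Existence form (no definition). The dual of `0 → Sel^{S₁} → Sel^{S₂}`; GV 2000 Cor. (2.3) / CGLS
2022 (1.6). [cite: GreenbergVatsal2000, §2 Cor. (2.3) (arXiv:math/9906215 pp. 20–21)] -/
theorem exists_restrict (h12 : S₁ ⊆ S₂) :
    ∃ r : XAc W p κ 𝔭 S₂ γ →ₗ[IwasawaAlgebra p] XAc W p κ 𝔭 S₁ γ,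
      (∀ (x : XAc W p κ 𝔭 S₂ γ) (s : selmerAc W p κ 𝔭 S₁),
        r x s = x (AddSubgroup.inclusion (selmerAc_mono W p κ 𝔭 h12) s)) ∧
      Function.Surjective r ∧
      ∀ x : XAc W p κ 𝔭 S₂ γ, r x = 0 ↔
        ∀ s : selmerAc W p κ 𝔭 S₁, x (AddSubgroup.inclusion (selmerAc_mono W p κ 𝔭 h12) s) = 0 := by
  have h₁ := isLocNil_conjSelmerAc_sub_one W p κ 𝔭 S₁ hγ.out
  have h₂ := isLocNil_conjSelmerAc_sub_one W p κ 𝔭 S₂ hγ.out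
  let r : XAc W p κ 𝔭 S₂ γ →ₗ[IwasawaAlgebra p] XAc W p κ 𝔭 S₁ γ :=
    { toFun := fun x ↦ (x : selmerAc W p κ 𝔭 S₂ →+ AddCircle (1 : ℚ)).comp
        (AddSubgroup.inclusion (selmerAc_mono W p κ 𝔭 h12))
      map_add' := fun x y ↦ DFunLike.ext _ _ fun c ↦ rfl
      map_smul' := fun f x ↦ by
        refine DFunLike.ext _ _ fun c ↦ ?_
        -- truncation parameters of `c` are admissible for its image in `Sel^{S₂}`
        have hN : ((conjSelmerAc W p κ 𝔭 S₂ γ - 1) ^ h₁.tN c)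
            (AddSubgroup.inclusion (selmerAc_mono W p κ 𝔭 h12) c) = 0 := by
          rw [← inclusion_conj_sub_one_pow_apply W p κ 𝔭 h12, h₁.tN_spec, map_zero]
        have hk : p ^ h₁.tk c • AddSubgroup.inclusion (selmerAc_mono W p κ 𝔭 h12) c = 0 := by
          rw [← map_nsmul, h₁.tk_spec, map_zero]
        change h₂.smulFun f x (AddSubgroup.inclusion (selmerAc_mono W p κ 𝔭 h12) c) =
          h₁.smulFun f ((x : selmerAc W p κ 𝔭 S₂ →+ AddCircle (1 : ℚ)).comp
            (AddSubgroup.inclusion (selmerAc_mono W p κ 𝔭 h12))) c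
        rw [h₂.smulFun_apply f x hN hk, h₁.smulFun_apply f _ (h₁.tN_spec c) (h₁.tk_spec c),
          IwasawaDual.evalT_def, IwasawaDual.evalT_def]
        refine Finset.sum_congr rfl fun i _ ↦ ?_
        rw [AddMonoidHom.comp_apply, inclusion_conj_sub_one_pow_apply W p κ 𝔭 h12] }
  -- values of `r` (stated through the `S₁`-side coercion first: a direct `rfl` against
  -- `x (ι s)` makes the kernel compare `XAc … S₁` with `XAc … S₂` and time out)
  have hr : ∀ (x : XAc W p κ 𝔭 S₂ γ) (s : selmerAc W p κ 𝔭 S₁),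
      r x s = x (AddSubgroup.inclusion (selmerAc_mono W p κ 𝔭 h12) s) := fun x s ↦
    (rfl : r x s = ((x : selmerAc W p κ 𝔭 S₂ →+ AddCircle (1 : ℚ)).comp
      (AddSubgroup.inclusion (selmerAc_mono W p κ 𝔭 h12))) s).trans (AddMonoidHom.comp_apply _ _ _)
  refine ⟨r, hr, fun y ↦ ?_, fun x ↦ ?_⟩
  · -- onto: extend the character `y` of `Sel^{S₁}` to `Sel^{S₂}` (`ℚ/ℤ` is injective)
    obtain ⟨χ', hχ'⟩ := CharacterModule.dual_surjective_of_injective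
      (AddSubgroup.inclusion (selmerAc_mono W p κ 𝔭 h12)).toIntLinearMap
      (AddSubgroup.inclusion_injective (selmerAc_mono W p κ 𝔭 h12))
      (y : selmerAc W p κ 𝔭 S₁ →+ AddCircle (1 : ℚ))
    refine ⟨(χ' : XAc W p κ 𝔭 S₂ γ), DFunLike.ext _ _ fun s ↦ ?_⟩
    have hs := DFunLike.congr_fun hχ' s
    rw [CharacterModule.dual_apply] at hs
    rw [hr]
    exact hs
  · -- kernel
    constructor
    · intro h s
      rw [← hr, h]
      rfl
    · intro h
      exact DFunLike.ext _ _ fun s ↦ (hr x s).trans (h s)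

/-- **`ker r ≃ Hom(Sel^{S₂}/Sel^{S₁}, ℚ/ℤ)`** for the restriction `r` of `exists_restrict` (any map
with the displayed values): a character of `Sel^{S₂}` vanishing on `Sel^{S₁}` is a character of the
quotient and conversely (`QuotientAddGroup.lift`) — Pontryagin duality of
`0 → Sel^{S₁} → Sel^{S₂} → Sel^{S₂}/Sel^{S₁} → 0`. [cite: GreenbergVatsal2000, §2 Cor. (2.3) (arXiv:math/9906215 pp. 20–21)] -/
theorem nonempty_ker_addEquiv_characterModule (h12 : S₁ ⊆ S₂)
    {Y : Type*} [AddCommGroup Y] [Module (IwasawaAlgebra p) Y] (r : XAc W p κ 𝔭 S₂ γ →ₗ[IwasawaAlgebra p] Y)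
    (hrker : ∀ x : XAc W p κ 𝔭 S₂ γ, r x = 0 ↔
      ∀ s : selmerAc W p κ 𝔭 S₁, x (AddSubgroup.inclusion (selmerAc_mono W p κ 𝔭 h12) s) = 0) :
    Nonempty (LinearMap.ker r ≃+
      CharacterModule (↥(selmerAc W p κ 𝔭 S₂) ⧸
        (selmerAc W p κ 𝔭 S₁).addSubgroupOf (selmerAc W p κ 𝔭 S₂))) := by
  set SS := selmerAc W p κ 𝔭 S₂ with hSS
  set S := selmerAc W p κ 𝔭 S₁ with hS
  have hle : S ≤ SS := selmerAc_mono W p κ 𝔭 h12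
  set N : AddSubgroup SS := S.addSubgroupOf SS with hN
  have hNmem : ∀ s : SS, s ∈ N ↔ (s : W.subgroupH1 p κ.kerSubgroup) ∈ S := fun s ↦
    AddSubgroup.mem_addSubgroupOf
  have hmk : ∀ s : S, QuotientAddGroup.mk' N (AddSubgroup.inclusion hle s) = 0 := fun s ↦ by
    rw [QuotientAddGroup.mk'_apply, QuotientAddGroup.eq_zero_iff, hNmem, AddSubgroup.coe_inclusion]
    exact s.2
  -- from characters of the quotient to the kernel
  have hmem : ∀ χ : CharacterModule (SS ⧸ N),
      (show XAc W p κ 𝔭 S₂ γ from AddMonoidHom.comp χ (QuotientAddGroup.mk' N)) ∈ LinearMap.ker r :=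
    fun χ ↦ by
    rw [LinearMap.mem_ker, hrker]
    intro s
    change χ (QuotientAddGroup.mk' N (AddSubgroup.inclusion hle s)) = 0
    rw [hmk, map_zero]
  let g : CharacterModule (SS ⧸ N) → LinearMap.ker r := fun χ ↦ ⟨_, hmem χ⟩
  have hgval : ∀ (χ : CharacterModule (SS ⧸ N)) (s : SS),
      ((g χ : LinearMap.ker r) : XAc W p κ 𝔭 S₂ γ) s = χ (QuotientAddGroup.mk' N s) := fun _ _ ↦ rfl
  have hg0 : g 0 = 0 := Subtype.ext (DFunLike.ext _ _ fun s ↦ by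
    rw [hgval]; rfl)
  have hgadd : ∀ χ χ', g (χ + χ') = g χ + g χ' := fun χ χ' ↦ Subtype.ext (DFunLike.ext _ _ fun s ↦ by
    rw [hgval]; rfl)
  let g' : CharacterModule (SS ⧸ N) →+ LinearMap.ker r :=
    { toFun := g, map_zero' := hg0, map_add' := hgadd }
  have hginj : Function.Injective g' := by
    intro χ χ' h
    refine AddMonoidHom.ext fun q ↦ ?_
    obtain ⟨s, rfl⟩ := QuotientAddGroup.mk'_surjective N q
    have h1 : ((g' χ : LinearMap.ker r) : XAc W p κ 𝔭 S₂ γ) s =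
        ((g' χ' : LinearMap.ker r) : XAc W p κ 𝔭 S₂ γ) s := by rw [h]
    exact ((hgval χ s).symm.trans h1).trans (hgval χ' s)
  have hgsurj : Function.Surjective g' := by
    rintro ⟨y, hy⟩
    have hkill : N ≤ (y : SS →+ AddCircle (1 : ℚ)).ker := fun n hn ↦ by
      rw [AddMonoidHom.mem_ker]
      have h := (hrker y).1 (LinearMap.mem_ker.1 hy) ⟨(n : W.subgroupH1 p κ.kerSubgroup), (hNmem n).1 hn⟩
      have e : AddSubgroup.inclusion hle ⟨(n : W.subgroupH1 p κ.kerSubgroup), (hNmem n).1 hn⟩ = n :=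
        Subtype.ext (AddSubgroup.coe_inclusion _ _)
      rw [e] at h
      exact h
    refine ⟨QuotientAddGroup.lift N (y : SS →+ AddCircle (1 : ℚ)) hkill, Subtype.ext ?_⟩
    refine DFunLike.ext _ _ fun s ↦ ?_
    change (QuotientAddGroup.lift N (y : SS →+ AddCircle (1 : ℚ)) hkill) (QuotientAddGroup.mk' N s) = y s
    exact QuotientAddGroup.lift_mk' N hkill s
  exact ⟨(AddEquiv.ofBijective g' ⟨hginj, hgsurj⟩).symm⟩

/-- `Sel^{S₂}/Sel^{S₁}` is `p`-primary (classes of `H¹(K_∞, E[p^∞])` are killed by powers of `p`).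
[cite: GreenbergLNM1716, §1 p. 60] -/
theorem isPrimary_quotient
    (q : ↥(selmerAc W p κ 𝔭 S₂) ⧸ (selmerAc W p κ 𝔭 S₁).addSubgroupOf (selmerAc W p κ 𝔭 S₂)) :
    ∃ n : ℕ, p ^ n • q = 0 := by
  induction q using QuotientAddGroup.induction_on with
  | H s =>
    obtain ⟨n, hn⟩ := W.exists_pow_smul_subgroupH1_ker_eq_zero κ (s : W.subgroupH1 p κ.kerSubgroup)
    refine ⟨n, ?_⟩
    have hs : p ^ n • s = 0 := Subtype.ext (by rw [AddSubgroupClass.coe_nsmul]; exact hn)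
    rw [← QuotientAddGroup.mk_nsmul, hs, QuotientAddGroup.mk_zero]

/-! ## §3. The `λ`-shift from `μ(X^{S₂}) = 0` -/

/-- **`λ(X^{S₂}) = λ(X^{S₁}) + corank_{ℤ_p}(Sel^{S₂}/Sel^{S₁})` when `μ(X^{S₂}) = 0`.** For Castella's
anticyclotomic Selmer duals `X^{Sᵢ} = Hom(Sel_𝔭^{Sᵢ}(K_∞, E[p^∞]), ℚ/ℤ)`, `S₁ ⊆ S₂`: if `X^{S₂}` is
finitely generated and `Λ`-torsion with `μ(X^{S₂}) = 0` then (i) `X^{S₁}` is finitely generated and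
`Λ`-torsion with `μ(X^{S₁}) = 0` (a quotient of `X^{S₂}` by the restriction `r`; `μ` additive),
(ii) the `p`-torsion of `Sel^{S₂}/Sel^{S₁}` is finite and (iii) `λ(X^{S₂}) = λ(X^{S₁}) +
corank_{ℤ_p}(Sel^{S₂}/Sel^{S₁})`: `λ` is additive along `r` (`X2.DualRestrictionInvariants`), and
`ker r ≅ Hom(Sel^{S₂}/Sel^{S₁}, ℚ/ℤ)` is finitely generated torsion with `μ(ker r) ≤ μ(X^{S₂}) = 0`,
whence `λ(ker r) = corank_{ℤ_p}(Sel^{S₂}/Sel^{S₁})` (`X2.NonPrimitiveSelmerCorank`; GV p. 21 "the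
`corank_𝒪` of a `Λ`-cotorsion group being the `λ`-invariant of its dual"). This is the module-theoretic
half of "`λ(𝔛_f^S) = λ(𝔛_f) + Σ_{w∈S} λ(𝒫_w(f))`" in the proofs of CGLS 2022 Thm. 1.5.1 / KY 2024
Thm. 1.5.1; the other half (the corank equals `Σ λ𝒫_w(f)`: Pollack–Weston surjectivity + local
Euler factors) is a published input typed separately.
[cite: GreenbergVatsal2000, §2 Cor. (2.3) and p. 21 (arXiv:math/9906215 pp. 20–21)]
[cite: KellerYin2024, proof of Thm. 1.5.1 (arXiv:2402.12781v2 TeX L1358–1360)] -/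
theorem lambdaInvariant_eq_add_zpCorank_of_muInvariant_eq_zero (h12 : S₁ ⊆ S₂)
    [Module.Finite (IwasawaAlgebra p) (XAc W p κ 𝔭 S₂ γ)]
    (htor : Module.IsTorsion (IwasawaAlgebra p) (XAc W p κ 𝔭 S₂ γ))
    (hμ : muInvariant p (XAc W p κ 𝔭 S₂ γ) = 0) :
    Module.Finite (IwasawaAlgebra p) (XAc W p κ 𝔭 S₁ γ) ∧
      Module.IsTorsion (IwasawaAlgebra p) (XAc W p κ 𝔭 S₁ γ) ∧
      muInvariant p (XAc W p κ 𝔭 S₁ γ) = 0 ∧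
      Finite ((↥(selmerAc W p κ 𝔭 S₂) ⧸
        (selmerAc W p κ 𝔭 S₁).addSubgroupOf (selmerAc W p κ 𝔭 S₂))[(p : ℤ)]) ∧
      lambdaInvariant p (XAc W p κ 𝔭 S₂ γ) = lambdaInvariant p (XAc W p κ 𝔭 S₁ γ) +
        zpCorank (↥(selmerAc W p κ 𝔭 S₂) ⧸
          (selmerAc W p κ 𝔭 S₁).addSubgroupOf (selmerAc W p κ 𝔭 S₂)) p := by
  obtain ⟨r, hr, hsurj, hker⟩ := exists_restrict W p κ 𝔭 γ h12
  obtain ⟨Ψ⟩ := nonempty_ker_addEquiv_characterModule W p κ 𝔭 γ h12 r hker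
  -- (i) the quotient `X^{S₁}`
  haveI hfg₁ : Module.Finite (IwasawaAlgebra p) (XAc W p κ 𝔭 S₁ γ) := Module.Finite.of_surjective r hsurj
  have htor₁ : Module.IsTorsion (IwasawaAlgebra p) (XAc W p κ 𝔭 S₁ γ) := fun y ↦ by
    obtain ⟨x, rfl⟩ := hsurj y
    obtain ⟨a, ha⟩ := @htor x
    exact ⟨a, by rw [Submonoid.smul_def, ← map_smul, ← Submonoid.smul_def, ha, map_zero]⟩
  have hμsum := X2.DualRestrictionInvariants.muInvariant_eq_add_of_surjective p r htor hsurj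
  have hμK : muInvariant p (LinearMap.ker r) = 0 := by
    have h := hμ; rw [hμsum] at h; omega
  have hμ₁ : muInvariant p (XAc W p κ 𝔭 S₁ γ) = 0 := by
    have h := hμ; rw [hμsum] at h; omega
  -- the kernel
  haveI : Module.Finite (IwasawaAlgebra p) (LinearMap.ker r) := Iwasawa.moduleFinite_ker p r
  have hKt : Module.IsTorsion (IwasawaAlgebra p) (LinearMap.ker r) := Iwasawa.isTorsion_ker p r htor
  obtain ⟨hfin, hcork⟩ :=
    X2.NonPrimitiveSelmerCorank.finite_torsionBy_and_zpCorank_eq_lambdaInvariant p (LinearMap.ker r)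
      hKt hμK (fun q ↦ isPrimary_quotient W p κ 𝔭 (S₁ := S₁) (S₂ := S₂) q) Ψ
  refine ⟨hfg₁, htor₁, hμ₁, hfin, ?_⟩
  rw [X2.DualRestrictionInvariants.lambdaInvariant_eq_add_of_surjective p r htor hsurj, hcork, add_comm]

end Summit.BirchSwinnertonDyer.BirchSwinnertonDyer.Theorems.XAcImprimitiveLambdaShift

end
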